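import Summits.BirchSwinnertonDyer.BirchSwinnertonDyer.Theorems.ErratumRoadFiveNonSurjCornerHybridDeepWitnessCore
import HarnessLib

/-!
# Route `ErratumRoadFive` (rung K2), crux `NonSurjCorner` (item stmt-BirchSwinnertonDyer-19065), REGISTERED line `Lines/hybrid.lean` (Hida-keyed):
# GLUE #21H — the composition of the r19 skeleton candidate (slot 1′ = ONE DEEP WITNESS per deep pair, slot 2′ = (2a)), and the projection
# r18 ⟹ r19 (Friedberg–Hoffstein + Mazur choose the witness's field and frame)
# (cell `bsd-stepL`, seat `bsd-stepL-corner-p1` g18; `--supports stmt-BirchSwinnertonDyer-19065 --as helper`)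

WHY THIS FILE. `…HybridDeepWitnessCore` (this seat g18) keys the converse half of the hybrid composition on ONE ∃-shaped deep witness per deep
corner pair (cf. RULING 33's ∃-recut of (Tw) at 3). This file is the line-of-record glue over it — glue #20H (`…HybridTwinMuAnDeepHida`) with
(slot 1, (2b)) ↦ slot 1′ `hWit` and slot 2 ↦ slot 2′ = (2a) alone — and the projection showing that r18's ∀-shaped slots produce the witness
(the field from the one-prime Friedberg–Hoffstein fact, the frame from Mazur's Manin-good datum; both are slot-3 facts), so registering r19 loses
nothing. After r19 the line's open converse-side content reads: «at each of the DEEP corner pairs (census: 1 ∕ 2 430 at 5, 0 ∕ 57 at 7) SOME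
Heegner field carries ONE refined-Kolyvagin certificate and ONE μ-certificate» — per pair one computation's worth of data.
* §1 GLUE #21H `nonSurjCorner_of_deepWitness_of_twinLowerMuAn_of_fifteenFacts_of_hidaFacts_of_twoPlusFourNamedInputs_of_carrierLabelsB6_pAnchor`;
* §2 `deepWitness_of_kolyZShaAn_of_twinMuAnDeep` — r18's slot 1 ∧ (2b) ⟹ slot 1′ (modulo `exists_isNewformOf`, Mazur 4.1, Friedberg–Hoffstein).

HONEST FRAMING: TWO THEOREMS (no definition, no named fact, no `sorry`); CONDITIONAL on every displayed binder; no stub is proved — two open inputs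
are asked existentially instead of universally; 19065 NOT closed by this file; nothing about any curve's BSD; BSD is not advanced; T7.
References (locators only): [cite: Cha2005, Thm. 21 and Rmk. 25] [cite: McCallumLMS1991, §5 Cor. 5.6] [cite: Kato2004Asterisque, Thm. 12.4, §17.13]
[cite: EmertonPollackWeston2006, Thm. 1, Thm. 3.1.1, Thm. 5.1.3] [cite: Wan2015, Thm. 4] [cite: Mazur1978, Cor. 4.1] [cite: FriedbergHoffstein1995, Thm. B]
[cite: GreenbergLNM1716, §1 Conj. 1.11 (p. 61)] [cite: PastenShimura2024, Prop. 6.13, Lemma 6.18] [cite: Miller2011LMS, Def. 1.1].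
-/

set_option autoImplicit false
set_option linter.dupNamespace false -- `Summit.BirchSwinnertonDyer.BirchSwinnertonDyer` (summit = problem), tree-wide

noncomputable section

open scoped Classical NumberField MatrixGroups ModularForm

/-! ### §1 Glue #21H: the line-of-record composition keyed on the deep witness -/

namespace Summit.BirchSwinnertonDyer.BirchSwinnertonDyer.Theorems

open CongruenceSubgroup WeierstrassCurve NumberField IsDedekindDomain Field Rat.HeightOneSpectrum
  Literature.NumberTheory.EllipticCurves
  Literature.NumberTheory.EllipticCurves.ModularForms
  Literature.NumberTheory.Automorphic
  Literature.NumberTheory.EllipticCurves.Rank1Residual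
  Literature.NumberTheory.EllipticCurves.Rank1Residual.Typed
  Literature.NumberTheory.EllipticCurves.Wuthrich2014
  Literature.NumberTheory.EllipticCurves.SteinWuthrich2013
  Literature.NumberTheory.EllipticCurves.Greenberg1999
  Literature.NumberTheory.EllipticCurves.Kato2004
  Literature.NumberTheory.EllipticCurves.BarriosEtAl2025
  Literature.NumberTheory.EllipticCurves.EmertonPollackWeston2006
  Literature.NumberTheory.EllipticCurves.ShimuraCMFamily
  Literature.NumberTheory.GaloisRepresentations Literature.NumberTheory.GaloisCohomology
  Summit.BirchSwinnertonDyer.Rank1Residual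
  Summit.BirchSwinnertonDyer.Rank1Residual.X11b
  Summit.BirchSwinnertonDyer.Rank1Residual.X11b.Three.Koly
  Summit.BirchSwinnertonDyer.BirchSwinnertonDyer.Theses.ErratumRoadFive

/-- **GLUE #21H — glue #20H with the converse half ∃-RECUT: slot 1′ = ONE DEEP WITNESS per deep pair, slot 2′ = (2a).** Binders: `hWit` (at each
deep corner pair SOME Heegner `K`, SOME Manin-good frame, a certificate there if deep, μ = 0 at that one twist) → `hμT` ((2a): μ = 0 at the leaf twins
with non-unit `#Ш_an`, the twin's LOWER half through x11a's per-pair door) → `hF3` (fifteen facts) → `hHida` (six) → hMax2 → hShim4 → `hLabB6T` →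
`NonSurjCorner`. Proof = glue #20H over `…HybridDeepWitnessCore` §2, the twin's Euler half built from Kato 12.4 + §17.13 V′∕VI′∕XI′ (Mazur 4.1) + SW 6.1
+ GS. CONDITIONAL on every binder; 19065 NOT closed; nothing booked; T7.
[cite: Kato2004Asterisque, Thm. 12.4, §17.13 (pp. 279–280)] [cite: EmertonPollackWeston2006, Thm. 5.1.3] [cite: Wan2015, Thm. 4] [cite: Mazur1978, Cor. 4.1]
[cite: Cha2005, Thm. 21 and Rmk. 25] [cite: McCallumLMS1991, §5 Cor. 5.6] [cite: PastenShimura2024, Lemma 6.18] [cite: Miller2011LMS, Def. 1.1] -/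
theorem nonSurjCorner_of_deepWitness_of_twinLowerMuAn_of_fifteenFacts_of_hidaFacts_of_twoPlusFourNamedInputs_of_carrierLabelsB6_pAnchor
    -- slot 1′ (r19): ONE DEEP WITNESS per deep corner pair (slots 1 + 2b of r18 merged, ∃-recut)
    (hWit : ∀ (W : WeierstrassCurve ℚ) [W.IsElliptic] [W.IsGloballyMinimal] (p : ℕ) [Fact p.Prime],
        ClassX11b W p → ¬ Surj W p → (p = 5 ∨ p = 7) → p ∣ padicValInt p W.minimalDiscriminantInt →
        ¬ Ram W p → (∃ s : ℚ, shaAn W = (s : ℂ) ∧ 0 < padicValRat p s) →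
        ∃ (N : ℕ) (_ : NeZero N) (K : Type) (_ : Field K) (_ : NumberField K)
          (Dt : ModularParametrizationData W N) (H : HeegnerDatum N (NumberField.discr K)) (ι : K →+* ℂ)
          (P : (W.baseChange K).toAffine.Point),
          W.conductorNorm ℤ = N ∧ IsImaginaryQuadratic K ∧ 4 < (NumberField.discr K).natAbs ∧
          SatisfiesHeegnerHypothesis N K ∧ (W.quadraticTwist (NumberField.discr K : ℚ)).entireLFunction 1 ≠ 0 ∧
          WeierstrassCurve.Affine.Point.map ι.toRatAlgHom P = heegnerPointComplex Dt H ∧ ¬ (p : ℤ) ∣ Dt.c ∧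
          ((∃ (d₁ : KolyvaginHeegnerData Dt H.β ι 1) (y : (W.baseChange K).toAffine.Point),
              WeierstrassCurve.Affine.Point.map (W' := W) (algebraMap K (ringClassField K ι 1)).toRatAlgHom y =
                d₁.derivedPoint ∧
              ∃ Q : (W.baseChange K).toAffine.Point, ((p ^ (padicValNat p W.tamagawaProduct + 1) : ℕ) : ℤ) • Q = y) →
            ∃ M : ℕ, M ≤ padicValNat p W.tamagawaProduct ∧ CertificateAt Dt H.β ι p M) ∧
          (∀ (Wd : WeierstrassCurve ℚ) [Wd.IsElliptic] [Wd.IsGloballyMinimal] (Cd : VariableChange ℚ),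
            Cd • W.quadraticTwist (NumberField.discr K : ℚ) = Wd →
            ClassX11a Wd p → ¬ Surj Wd p → p ∣ padicValInt p Wd.minimalDiscriminantInt →
            ∀ {N : ℕ} [NeZero N] (f : CuspForm (Gamma0 N) 2), IsNewformOf Wd f →
            ∀ (ϖ : ℚ), (ϖ : ℝ) * Wd.realPeriodRat = plusPeriod f →
            ∀ (a : ℚ_[p]) (L : PowerSeries ℚ_[p]),
              (Wd.HasSplitMultiplicativeReductionAtPrime p → a = 1) →
              (¬ Wd.HasSplitMultiplicativeReductionAtPrime p → a = -1) →
              IsMultPAdicLFunctionOf f p a L →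
              ∃ n : ℕ, ‖PowerSeries.coeff n (PowerSeries.C ((ϖ : ℚ) : ℚ_[p]) * L)‖ = 1))
    -- slot 2′ (r19): μ = 0 ONLY at the non-surjective X11a leaf twins whose own #Ш_an is not a p-unit (= (2a) of r18: the twin's LOWER half)
    (hμT : ∀ (Wd : WeierstrassCurve ℚ) [Wd.IsElliptic] [Wd.IsGloballyMinimal] (p : ℕ) [Fact p.Prime],
        ClassX11a Wd p → ¬ Surj Wd p → (p = 5 ∨ p = 7) → p ∣ padicValInt p Wd.minimalDiscriminantInt →
        ¬ X11a.ShaAnUnit Wd p →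
        ∀ {N : ℕ} [NeZero N] (f : CuspForm (Gamma0 N) 2), IsNewformOf Wd f →
        ∀ (ϖ : ℚ), (ϖ : ℝ) * Wd.realPeriodRat = plusPeriod f →
        ∀ (a : ℚ_[p]) (L : PowerSeries ℚ_[p]),
          (Wd.HasSplitMultiplicativeReductionAtPrime p → a = 1) →
          (¬ Wd.HasSplitMultiplicativeReductionAtPrime p → a = -1) →
          IsMultPAdicLFunctionOf f p a L →
          ∃ n : ℕ, ‖PowerSeries.coeff n (PowerSeries.C ((ϖ : ℚ) : ℚ_[p]) * L)‖ = 1)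
    -- slot 3 (r14): FIFTEEN named facts — r11–r13's sixteen minus conjunct 16 (Cha 2005 Rmk. 25 upper, discharged inside on the corner)
    (hF3 :
      (∀ (N : ℕ) [NeZero N] (W : WeierstrassCurve ℚ) (K : Type) [Field K] [NumberField K], Literature.NumberTheory.EllipticCurves.gross_zagier N W K) ∧
      (∀ (N : ℕ) [NeZero N] (W : WeierstrassCurve ℚ) (K : Type) [Field K] [NumberField K], Literature.NumberTheory.EllipticCurves.kolyvagin N W K) ∧
      Literature.NumberTheory.EllipticCurves.Wuthrich2014.sha_dvd_analyticSha ∧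
      Literature.NumberTheory.EllipticCurves.rank_eq_analyticRank_of_analyticRank_le_one ∧
      Literature.NumberTheory.EllipticCurves.ModularForms.exists_isNewformOf ∧
      Literature.NumberTheory.EllipticCurves.friedbergHoffstein_exists_heegnerField_split_twist_ne_zero ∧
      Literature.NumberTheory.EllipticCurves.ModularForms.mazur_not_dvd_maninConstant_of_odd ∧
      Literature.NumberTheory.EllipticCurves.SteinWuthrich2013.thm61_splitMultiplicative ∧
      Literature.NumberTheory.EllipticCurves.SteinWuthrich2013.thm61_nonsplitMultiplicative ∧
      (∀ (W : WeierstrassCurve ℚ) [W.IsElliptic] [W.IsGloballyMinimal] (p : ℕ) [Fact p.Prime], Literature.NumberTheory.EllipticCurves.greenberg_stevens (W := W) (p := p)) ∧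
      Literature.NumberTheory.EllipticCurves.Cha2005.rmk25_pow_dvd_card_sha_primary_of_certificate ∧
      Literature.NumberTheory.EllipticCurves.Kato2004.thm12_4 ∧
      Literature.NumberTheory.EllipticCurves.Kato2004.exists_multDivisibilityInputs_nonsplit_contra ∧
      Literature.NumberTheory.EllipticCurves.Kato2004.exists_multDivisibilityInputs_split_contra ∧
      Literature.NumberTheory.EllipticCurves.Kato2004.exists_multDivisibilityInputs_fine_contra)
    -- slot 4 (r7): the six Hida-side NAMED facts of x11a's non-surjective chain
    (hHida : EmertonPollackWeston2006.thm311_cotorsion_weightK_member_ofLevel ∧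
      EmertonPollackWeston2006.thm1_muAlg_of_weightK_member_ofLevel ∧
      Wan2015.thm4_rational_weightK_member_of_bdd_ofLevel_irred ∧
      EmertonPollackWeston2006.thm513_transfer_from_weightK_member_of_bdd_ofLevel ∧
      DeligneSerre1974.thm61_exists_adicGaloisRep ∧ Hida2000_thm326_ordinary)
    -- slot 5, conjunct 1 (r16): TWO names — Poitou–Tate for Selmer structures is a tree theorem (selmerComplement_canonical_holds)
    (hMax2 : GrossLMS1991.prop37_2_frobeniusCongruence ∧ Gross1991_heegnerPoint_sub_ratTorsion_mem_E0_imageFree)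
    -- slot 5, conjunct 2 (r17): FOUR Shimura names — the CM primitives come from slot 6's labelled family
    (hShim4 : friedbergHoffstein_exists_twist_ne_zero_inertAt ∧ nonempty_shimuraParametrizationData ∧
      PastenShimura2024_componentOrders ∧
      (∀ (K : Type) [Field K] [NumberField K], casselsTate_levelInputs K))
    -- slot 6 (r10): the labelled CM family at the corner's inert frames with `d_K < −4`, WITH (B6) ONLY AT THE CARRIER PRIMES outside `S`
    (hLabB6T : ∀ (W : WeierstrassCurve ℚ) [W.IsElliptic] [W.IsGloballyMinimal] (p : ℕ) [Fact p.Prime],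
      ClassX11b W p → ¬ Surj W p → (p = 5 ∨ p = 7) →
      ∀ (N : ℕ) [NeZero N] (K : Type) [Field K] [NumberField K] (S : Finset ℕ) (Dt : ModularParametrizationData W N)
        (X : ShimuraCurveData (∏ q ∈ S, q) (N / ∏ q ∈ S, q)) (W' : WeierstrassCurve ℚ) [W'.IsElliptic]
        (P₀ : ShimuraParametrizationData X W'),
        W.conductorNorm ℤ = N → IsImaginaryQuadratic K → NumberField.discr K < -4 → Even S.card →
        (∀ ℓ ∈ S, ℓ.Prime ∧ ℓ ∣ N ∧ ¬ ℓ ^ 2 ∣ N ∧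
          ((Ideal.span {(ℓ : ℤ)}).primesOver (𝓞 K)).ncard = 1 ∧ ¬ (ℓ : ℤ) ∣ NumberField.discr K) →
        (∀ ℓ : ℕ, ℓ.Prime → ℓ ∣ N → ℓ ∉ S → ((Ideal.span {(ℓ : ℤ)}).primesOver (𝓞 K)).ncard = 2) →
        p ∈ S → ¬ (p : ℤ) ∣ Dt.c → P₀.IsMinimalFor W →
        ∃ (ι : K →+* ℂ) (y : (W.baseChange K).toAffine.Point) (degy : ℕ)
          (ys : (m : ℕ) → (W.baseChange (ringClassField K ι m)).toAffine.Point) (ε : ℤ), 0 < degy ∧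
          padicValNat p degy = padicValNat p P₀.deg ∧
          LDerivEK W K = 8 * (Real.pi : ℂ) ^ 2 * peterssonProduct (CongruenceSubgroup.Gamma0 N) 2 Dt.f Dt.f /
              ((((Units.torsionOrder K : ℝ) / 2) ^ 2 * √|(NumberField.discr K : ℝ)| : ℝ) : ℂ) *
            ((y.canonicalHeight : ℂ) / (degy : ℂ)) ∧
          (¬ IsOfFinAddOrder y → 0 < (AddSubgroup.zmultiples y).index) ∧
          ShimuraWalk.LabelsAt W N K ι y ys ε ∧
          ∀ (q : ℕ) [Fact q.Prime], q ∣ N → q ∉ S → p ∣ (W.baseChange ℚ_[q]).localTamagawaNumber ℤ_[q] → LabelB6 ι W N {q} ys) :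
    Summit.BirchSwinnertonDyer.BirchSwinnertonDyer.Theses.ErratumRoadFive.NonSurjCorner := by
  obtain ⟨hGZ, hKo, -, hGZK, hnf, hFHs, hMaz, hJs, hJn, hGS, hChaL, h12, hns', hsp', hfine'⟩ := hF3
  obtain ⟨h311, hT1a, hT2, hT1b, h61, h326⟩ := hHida
  obtain ⟨h37, hF1⟩ := hMax2
  -- Poitou–Tate duality for the tree's Selmer structures: a THEOREM (Milne I 4.10(b) for the canonical maps, cell bsd-schneider p626891)
  have hPTs : ∀ (K : Type) [Field K] [NumberField K], poitouTate_selmerStructure_duality_conj K :=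
    poitouTate_conj_forall_of_selmerComplement_canonical
      (fun K _ _ n _ ↦ SchneiderFreeAdditiveX3.PoitouTateReduction.selmerComplement_canonical_holds K n)
  obtain ⟨hFH, hJL, hCO, hCT⟩ := hShim4
  -- the seven former slot-3 conjuncts that are THEOREMS of the tree
  have hmod : hasEntireLFunction_rat := hasEntireLFunction_rat_of_exists_isNewformOf hnf
  have hpar : nonempty_modularParametrizationData :=
    nonempty_modularParametrizationData_of_exists_isNewformOf hnf IsNewformOf.exists_maninConstant_ne_zero_holds
  have hrec : ∀ (N : ℕ) [NeZero N] (W : WeierstrassCurve ℚ) (K : Type) [Field K] [NumberField K],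
      heegnerPointOfConductor_one_galoisConj N W K :=
    fun N _ W K _ _ ↦ heegnerPointOfConductor_one_galoisConj_holds N W K
  have hD36 : ∀ (N : ℕ) [NeZero N] (W : WeierstrassCurve ℚ) (K : Type) [Field K] [NumberField K],
      phi_heegnerTau_mem_singularModuliField N W K :=
    fun N _ W K _ _ ↦ phi_heegnerTau_mem_singularModuliField_holds N W K
  have hPT : ∀ (K : Type) [Field K] [NumberField K],
      Literature.NumberTheory.GaloisCohomology.poitouTate_sum_localTatePairing_eq_zero K :=
    poitouTate_sum_localTatePairing_eq_zero_holds
  have hBR : localTamagawaNumber_quadraticTwist_two_mem_of_goodReduction :=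
    BarriosEtAl2025.localTamagawaNumber_quadraticTwist_two_mem_of_goodReduction_holds
  -- slot 4: the leaf-twin lower half AT THE TWINS WITH NON-UNIT #Ш_an, from (2a) pointwise + the six Hida facts (x11a's `_of_mazur` door)
  have h₄ℓ : ∀ (Wd : WeierstrassCurve ℚ) [Wd.IsElliptic] [Wd.IsGloballyMinimal] (p : ℕ) [Fact p.Prime],
      ClassX11a Wd p → ¬ Surj Wd p → (p = 5 ∨ p = 7) → p ∣ padicValInt p Wd.minimalDiscriminantInt →
      ¬ X11a.ShaAnUnit Wd p → Typed.MissingLowerBoundAt Wd p :=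
    fun Wd _ _ p _ hXa hnsd h57 hvd hsu ↦
      hXa.missingLowerBoundAt_of_muAnZeroAt_of_not_surj_of_contraFacts_of_mazur hnf h311 hT1a hT2 hT1b h61 h326 h12 hns'
        hsp' hfine' hMaz hJs hJn hGZK (hGS Wd p) hnsd (by rcases h57 with rfl | rfl <;> omega)
        (NonSurjChain.muAnZeroAt_of_allowableRootShape Wd p (fun f hf ϖ hϖ a L h1 h2 hL ↦
          hμT Wd p hXa hnsd h57 hvd hsu f hf ϖ hϖ a L h1 h2 hL))
  exact X11b.erratumRoadFive_nonSurjCorner_of_deepWitness_of_kolyJMax_of_multiUpper_of_lowerLeafTwinDeep_of_twinUpper_of_casselsTate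
    hGZ hKo hGZK hmod hnf hFHs hMaz hrec hD36 hChaL hCT h37 h₄ℓ
    (X11b.Three.Koly.nonSurjCornerKolyJ_max_of_threeNamedFacts h37 hPTs hF1)
    (fun W _ _ p _ hX hns' h57 hv hnr htam hmulti ↦
      NonSurjCorner.missingUpperBoundAt_of_carrierLabelsB6_of_twinLower_pAnchor hGZK hmod hnf hMaz hBR hJL hCO hPT hPTs hCT hLabB6T W p hX
        hns' h57 htam hmulti (NonSurjCorner.fhTwinLowerSupplyAt_of_lowerLeafTwinDeep hGZK hmod hnf hFH h₄ℓ W p hX hns' h57 hv hnr))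
    (fun Wd _ _ p _ hXa hnsd hvd hμc ↦
      missingUpperBoundAt_of_classX11a_of_multDivisibilityAt hJs hJn hGZK hmod hpar Wd p (hGS Wd p) hXa
        (X11b.multDivisibilityAt_of_katoFacts_of_muAn_contra_of_mazur Kato2004.nonempty_iwasawaH1Data_holds h12 hnf hns' hsp' hfine'
          hMaz Wd p hXa.2.1 hXa.2.2.1 hXa.2.2.2.1 hnsd hμc))
    hWit

/-! ### §2 r18's slots 1 + 2b imply the deep witness (Friedberg–Hoffstein + Mazur's Manin datum choose the field and the frame) -/

/-- **r18's converse-half slots imply the ∃-witness**: given modularity (`exists_isNewformOf`, for the sign and the parametrisation), Mazur 1978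
Cor. 4.1 (a Manin-good datum with `p ∤ c`) and the one-prime Friedberg–Hoffstein fact (a Heegner field with `|d_K| > 4`, `p` split, `L(E^{(d_K)},1) ≠ 0`)
— all three conjuncts of slot 3 — the ∀-shaped slot 1 (deep certificates at every frame) and (2b) (μ = 0 at every Friedberg–Hoffstein twist) of r18
produce the witness at the field and frame so chosen. So every stub-worker result against r17 ∕ r18 transfers to r19. Nothing asserted about any curve.
[cite: FriedbergHoffstein1995, Thm. B] [cite: Mazur1978, Cor. 4.1] -/
theorem deepWitness_of_kolyZShaAn_of_twinMuAnDeep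
    (hnf : exists_isNewformOf) (hMaz : mazur_not_dvd_maninConstant_of_odd)
    (hFHs : friedbergHoffstein_exists_heegnerField_split_twist_ne_zero)
    (hZan : ∀ (W : WeierstrassCurve ℚ) [W.IsElliptic] [W.IsGloballyMinimal] (p : ℕ) [Fact p.Prime]
        (N : ℕ) [NeZero N] (K : Type) [Field K] [NumberField K]
        (Dt : ModularParametrizationData W N) (β : ℤ) (ι : K →+* ℂ),
        ClassX11b W p → ¬ Surj W p → (p = 5 ∨ p = 7) → p ∣ padicValInt p W.minimalDiscriminantInt →
        ¬ Ram W p → (∃ s : ℚ, shaAn W = (s : ℂ) ∧ 0 < padicValRat p s) →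
        W.conductorNorm ℤ = N → IsImaginaryQuadratic K →
        4 < (NumberField.discr K).natAbs → SatisfiesHeegnerHypothesis N K →
        SatisfiesHeegnerHypothesis p K → (4 * (N : ℤ)) ∣ β ^ 2 - NumberField.discr K → ¬ (p : ℤ) ∣ Dt.c →
        (∃ (d₁ : KolyvaginHeegnerData Dt β ι 1) (y : (W.baseChange K).toAffine.Point),
          WeierstrassCurve.Affine.Point.map (W' := W) (algebraMap K (ringClassField K ι 1)).toRatAlgHom y =
            d₁.derivedPoint ∧
          ∃ Q : (W.baseChange K).toAffine.Point, ((p ^ (padicValNat p W.tamagawaProduct + 1) : ℕ) : ℤ) • Q = y) →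
        ∃ M : ℕ, M ≤ padicValNat p W.tamagawaProduct ∧ CertificateAt Dt β ι p M)
    (hμD : ∀ (W : WeierstrassCurve ℚ) [W.IsElliptic] [W.IsGloballyMinimal] (p : ℕ) [Fact p.Prime],
        ClassX11b W p → ¬ Surj W p → (p = 5 ∨ p = 7) → p ∣ padicValInt p W.minimalDiscriminantInt →
        ¬ Ram W p → (∃ s : ℚ, shaAn W = (s : ℂ) ∧ 0 < padicValRat p s) →
        ∀ (K : Type) [Field K] [NumberField K] (Wd : WeierstrassCurve ℚ) [Wd.IsElliptic] [Wd.IsGloballyMinimal]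
          (Cd : VariableChange ℚ),
          IsImaginaryQuadratic K → SatisfiesHeegnerHypothesis (W.conductorNorm ℤ) K →
          (W.quadraticTwist (NumberField.discr K : ℚ)).entireLFunction 1 ≠ 0 →
          Cd • W.quadraticTwist (NumberField.discr K : ℚ) = Wd →
          ClassX11a Wd p → ¬ Surj Wd p → p ∣ padicValInt p Wd.minimalDiscriminantInt →
          ∀ {N : ℕ} [NeZero N] (f : CuspForm (Gamma0 N) 2), IsNewformOf Wd f →
          ∀ (ϖ : ℚ), (ϖ : ℝ) * Wd.realPeriodRat = plusPeriod f →
          ∀ (a : ℚ_[p]) (L : PowerSeries ℚ_[p]),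
            (Wd.HasSplitMultiplicativeReductionAtPrime p → a = 1) →
            (¬ Wd.HasSplitMultiplicativeReductionAtPrime p → a = -1) →
            IsMultPAdicLFunctionOf f p a L →
            ∃ n : ℕ, ‖PowerSeries.coeff n (PowerSeries.C ((ϖ : ℚ) : ℚ_[p]) * L)‖ = 1) :
    ∀ (W : WeierstrassCurve ℚ) [W.IsElliptic] [W.IsGloballyMinimal] (p : ℕ) [Fact p.Prime],
      ClassX11b W p → ¬ Surj W p → (p = 5 ∨ p = 7) → p ∣ padicValInt p W.minimalDiscriminantInt →
      ¬ Ram W p → (∃ s : ℚ, shaAn W = (s : ℂ) ∧ 0 < padicValRat p s) →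
      ∃ (N : ℕ) (_ : NeZero N) (K : Type) (_ : Field K) (_ : NumberField K)
        (Dt : ModularParametrizationData W N) (H : HeegnerDatum N (NumberField.discr K)) (ι : K →+* ℂ)
        (P : (W.baseChange K).toAffine.Point),
        W.conductorNorm ℤ = N ∧ IsImaginaryQuadratic K ∧ 4 < (NumberField.discr K).natAbs ∧
        SatisfiesHeegnerHypothesis N K ∧ (W.quadraticTwist (NumberField.discr K : ℚ)).entireLFunction 1 ≠ 0 ∧
        WeierstrassCurve.Affine.Point.map ι.toRatAlgHom P = heegnerPointComplex Dt H ∧ ¬ (p : ℤ) ∣ Dt.c ∧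
        ((∃ (d₁ : KolyvaginHeegnerData Dt H.β ι 1) (y : (W.baseChange K).toAffine.Point),
            WeierstrassCurve.Affine.Point.map (W' := W) (algebraMap K (ringClassField K ι 1)).toRatAlgHom y =
              d₁.derivedPoint ∧
            ∃ Q : (W.baseChange K).toAffine.Point, ((p ^ (padicValNat p W.tamagawaProduct + 1) : ℕ) : ℤ) • Q = y) →
          ∃ M : ℕ, M ≤ padicValNat p W.tamagawaProduct ∧ CertificateAt Dt H.β ι p M) ∧
        (∀ (Wd : WeierstrassCurve ℚ) [Wd.IsElliptic] [Wd.IsGloballyMinimal] (Cd : VariableChange ℚ),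
          Cd • W.quadraticTwist (NumberField.discr K : ℚ) = Wd →
          ClassX11a Wd p → ¬ Surj Wd p → p ∣ padicValInt p Wd.minimalDiscriminantInt →
          ∀ {N : ℕ} [NeZero N] (f : CuspForm (Gamma0 N) 2), IsNewformOf Wd f →
          ∀ (ϖ : ℚ), (ϖ : ℝ) * Wd.realPeriodRat = plusPeriod f →
          ∀ (a : ℚ_[p]) (L : PowerSeries ℚ_[p]),
            (Wd.HasSplitMultiplicativeReductionAtPrime p → a = 1) →
            (¬ Wd.HasSplitMultiplicativeReductionAtPrime p → a = -1) →
            IsMultPAdicLFunctionOf f p a L →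
            ∃ n : ℕ, ‖PowerSeries.coeff n (PowerSeries.C ((ϖ : ℚ) : ℚ_[p]) * L)‖ = 1) := by
  intro W _ _ p _ hX hns h57 hv hnr hspos
  have hNS : integral_neronScaling_of_isGloballyMinimal := integral_neronScaling_of_isGloballyMinimal_holds
  have hp : p.Prime := Fact.out
  have hp5 : 5 ≤ p := by rcases h57 with h | h <;> omega
  obtain ⟨hr, hp2, hmult, hirr⟩ := id hX
  haveI : NeZero (W.conductorNorm ℤ) := ⟨(W.conductorNorm_pos_holds).ne'⟩
  have hw : W.rootNumber = -1 := by
    rw [WeierstrassCurve.rootNumber_eq_neg_one_pow_analyticRank_of_exists_isNewformOf hnf W, hr]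
    norm_num
  -- the Friedberg–Hoffstein field and Mazur's Manin-good datum
  obtain ⟨K, _, _, hK, hdisc, hHN, hHp, hLt⟩ := hFHs W hw p hp 4
  obtain ⟨Dt, H, ι, P, hP, hc⟩ :=
    exists_maninDatum hnf hMaz hNS W p (W.conductorNorm ℤ) K rfl hp5 hmult hirr hK hHN
  exact ⟨W.conductorNorm ℤ, inferInstance, K, inferInstance, inferInstance, Dt, H, ι, P, rfl, hK, hdisc, hHN, hLt, hP, hc,
    fun hdeep ↦ hZan W p _ K Dt H.β ι hX hns h57 hv hnr hspos rfl hK hdisc hHN hHp H.dvd_sq_sub hc hdeep,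
    fun Wd _ _ Cd hWd hXa hnsd hvd N _ f hf ϖ hϖ a L hsa hna hL ↦
      hμD W p hX hns h57 hv hnr hspos K Wd Cd hK hHN hLt hWd hXa hnsd hvd f hf ϖ hϖ a L hsa hna hL⟩

end Summit.BirchSwinnertonDyer.BirchSwinnertonDyer.Theorems

end
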